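import Summits.QuantumFields.YangMills.Theorems.CurvatureKernelBound.Negative.L1Flat

/-!
# `CurvatureKernelBound` — negative lemmas, `ℓ¹` witness III: the two-point functional `T` (Hahn–Banach) and `⁰𝒮`-stability

Supports crux item `stmt-QuantumFields-11687` (`PencilRigidity.CurvatureKernelBound`). Standing disprover's negative
lemmas (refuter, cdisprove cycle 3), ORDER-INSUFFICIENCY WITH REGULARITY chain `L1Kernel → L1Flat → L1Extension →
L1Package → L1RPKernel → L1RP → L1Main`, culminating in `L1Witness.not_axialGrowthOfTwoPointPackage`: the two-point
shadow of `W₁ ∖ lattice` plus a representing kernel continuous off `0` do NOT imply the axial growth bound of Stub E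
(`AxialGrowth`) of line `sixteen-charts-analytic-kernel`. No conclusion below asserts a Theses statement positively.

`⁰𝒮` as a `ℂ`-submodule (`offDiag`), the functional `ℓ F = ∫ K(x₀−x₁) F` on it, its real part as a partially
defined real functional dominated by the seminorm `Cbd · SN 9 10` (`ellR`), a Hahn–Banach extension
(`exists_extension_of_le_sublinear`), complexification (`Module.Dual.extendRCLike`) with the same bound
(`norm_Tlin_le`), and the continuous linear functional `T` on `𝓢((ℝ⁴)², ℂ)` (`SchwartzMap.mkCLMtoNormedSpace`; the
seminorm family is bridged syntactically by `seminormFamily_eq`) with `T_eq_integral : T F = ∫ K(x₀−x₁) F` on `⁰𝒮`.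
Then stability of `⁰𝒮` under translations, diagonal isometries, permutations, conjugation and the OS adjoint, and
the changes of variables used by the package. [folklore]
-/

open scoped BigOperators Topology SchwartzMap
open MeasureTheory Filter Set Real
open Literature.MathematicalPhysics.QuantumLattice Literature.MathematicalPhysics.AQFT

noncomputable section

namespace Summit.QuantumFields.YangMills.Theorems.CurvatureKernelBound.Negative

namespace L1Witness

/-! ### `⁰𝒮` as a subspace, the functional `ℓ F = ∫ K F`, and a continuous extension `T` -/

section Extension

/-- `⁰𝒮((ℝ⁴)²)` as a `ℂ`-submodule of the Schwartz space. -/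
def offDiag : Submodule ℂ 𝓢((Fin 2 → E4), ℂ) where
  carrier := {F | IsOffDiagonal F}
  add_mem' hF hG := hF.add hG
  zero_mem' := isOffDiagonal_zero
  smul_mem' c _ hF := hF.smul c

/-- Auxiliary fact `mem_offDiag` of the `ℓ¹`-witness construction (see the module docstring). [folklore] -/
theorem mem_offDiag {F : 𝓢((Fin 2 → E4), ℂ)} : F ∈ offDiag ↔ IsOffDiagonal F := Iff.rfl

/-- The functional `ℓ F = ∫ K(x₀−x₁) F(x) dx` (meaningful on `⁰𝒮`). -/
def ell (F : 𝓢((Fin 2 → E4), ℂ)) : ℂ := ∫ x, KC x * F x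

/-- Auxiliary fact `ell_add` of the `ℓ¹`-witness construction (see the module docstring). [folklore] -/
theorem ell_add {F G : 𝓢((Fin 2 → E4), ℂ)} (hF : IsOffDiagonal F) (hG : IsOffDiagonal G) :
    ell (F + G) = ell F + ell G := by
  have h : ∀ x, (F + G) x = F x + G x := fun _ => rfl
  simp only [ell, h, mul_add]
  exact integral_add (integrable_KC_mul hF) (integrable_KC_mul hG)

/-- Auxiliary fact `ell_smul` of the `ℓ¹`-witness construction (see the module docstring). [folklore] -/
theorem ell_smul (c : ℂ) (F : 𝓢((Fin 2 → E4), ℂ)) : ell (c • F) = c * ell F := by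
  have h : ∀ x, (c • F) x = c * F x := fun _ => rfl
  simp only [ell, h, ← integral_const_mul]
  congr 1; funext x; ring

/-- Auxiliary fact `norm_ell_le` of the `ℓ¹`-witness construction (see the module docstring). [folklore] -/
theorem norm_ell_le {F : 𝓢((Fin 2 → E4), ℂ)} (hF : IsOffDiagonal F) : ‖ell F‖ ≤ Cbd * SN 9 10 F :=
  norm_integral_KC_mul_le hF

/-- Auxiliary fact `real_smul_eq` of the `ℓ¹`-witness construction (see the module docstring). [folklore] -/
theorem real_smul_eq (c : ℝ) (F : 𝓢((Fin 2 → E4), ℂ)) : c • F = (c : ℂ) • F := by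
  ext x; simp

/-- The dominating seminorm `N F = Cbd · SN 9 10 F`. -/
def Nsem (F : 𝓢((Fin 2 → E4), ℂ)) : ℝ := Cbd * SN 9 10 F

/-- Auxiliary fact `Nsem_smul` of the `ℓ¹`-witness construction (see the module docstring). [folklore] -/
theorem Nsem_smul (c : ℂ) (F : 𝓢((Fin 2 → E4), ℂ)) : Nsem (c • F) = ‖c‖ * Nsem F := by
  simp only [Nsem, SN, map_smul_eq_mul]; ring

/-- Auxiliary fact `Nsem_add` of the `ℓ¹`-witness construction (see the module docstring). [folklore] -/
theorem Nsem_add (F G : 𝓢((Fin 2 → E4), ℂ)) : Nsem (F + G) ≤ Nsem F + Nsem G := by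
  simp only [Nsem, SN]
  rw [← mul_add]
  exact mul_le_mul_of_nonneg_left (map_add_le_add _ F G) Cbd_nonneg

/-- The real part of `ℓ` on `⁰𝒮` as a partially defined `ℝ`-linear functional. -/
def ellR : 𝓢((Fin 2 → E4), ℂ) →ₗ.[ℝ] ℝ where
  domain := offDiag.restrictScalars ℝ
  toFun :=
    { toFun := fun F => (ell F.1).re
      map_add' := fun F G => by
        have hF : IsOffDiagonal F.1 := F.2
        have hG : IsOffDiagonal G.1 := G.2
        simp only [Submodule.coe_add, ell_add hF hG, Complex.add_re]
      map_smul' := fun c F => by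
        simp only [Submodule.coe_smul_of_tower, RingHom.id_apply, smul_eq_mul]
        rw [real_smul_eq, ell_smul, Complex.re_ofReal_mul] }

/-- Auxiliary fact `ellR_apply` of the `ℓ¹`-witness construction (see the module docstring). [folklore] -/
theorem ellR_apply (F : ellR.domain) : ellR F = (ell F.1).re := rfl

/-- A real-linear extension of `re ∘ ℓ` to the whole Schwartz space, dominated by `N`. -/
theorem exists_extension : ∃ g : 𝓢((Fin 2 → E4), ℂ) →ₗ[ℝ] ℝ,
    (∀ F : 𝓢((Fin 2 → E4), ℂ), IsOffDiagonal F → g F = (ell F).re) ∧ ∀ F, g F ≤ Nsem F := by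
  obtain ⟨g, hg1, hg2⟩ := exists_extension_of_le_sublinear ellR Nsem
    (fun c hc F => by rw [real_smul_eq, Nsem_smul, Complex.norm_real, Real.norm_of_nonneg hc.le])
    Nsem_add (fun F => by
      rw [ellR_apply]
      exact (Complex.re_le_norm _).trans (norm_ell_le F.2))
  exact ⟨g, fun F hF => hg1 ⟨F, hF⟩, hg2⟩

/-- The chosen real extension. -/
def gR : 𝓢((Fin 2 → E4), ℂ) →ₗ[ℝ] ℝ := exists_extension.choose

/-- Auxiliary fact `gR_eq` of the `ℓ¹`-witness construction (see the module docstring). [folklore] -/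
theorem gR_eq {F : 𝓢((Fin 2 → E4), ℂ)} (hF : IsOffDiagonal F) : gR F = (ell F).re :=
  exists_extension.choose_spec.1 F hF

/-- Auxiliary fact `gR_le` of the `ℓ¹`-witness construction (see the module docstring). [folklore] -/
theorem gR_le (F : 𝓢((Fin 2 → E4), ℂ)) : gR F ≤ Nsem F := exists_extension.choose_spec.2 F

/-- Auxiliary fact `Nsem_neg` of the `ℓ¹`-witness construction (see the module docstring). [folklore] -/
theorem Nsem_neg (F : 𝓢((Fin 2 → E4), ℂ)) : Nsem (-F) = Nsem F := by
  rw [← neg_one_smul ℂ F, Nsem_smul]; simp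

/-- Auxiliary fact `abs_gR_le` of the `ℓ¹`-witness construction (see the module docstring). [folklore] -/
theorem abs_gR_le (F : 𝓢((Fin 2 → E4), ℂ)) : |gR F| ≤ Nsem F := by
  refine abs_le.2 ⟨?_, gR_le F⟩
  have h := gR_le (-F)
  rw [map_neg, Nsem_neg] at h
  linarith

/-- The complex-linear extension (algebraic). -/
def Tlin : 𝓢((Fin 2 → E4), ℂ) →ₗ[ℂ] ℂ := Module.Dual.extendRCLike (𝕜 := ℂ) gR

/-- Auxiliary fact `norm_Tlin_le` of the `ℓ¹`-witness construction (see the module docstring). [folklore] -/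
theorem norm_Tlin_le (F : 𝓢((Fin 2 → E4), ℂ)) : ‖Tlin F‖ ≤ Nsem F := by
  have hsq := Module.Dual.norm_extendRCLike_apply_sq (𝕜 := ℂ) gR F
  have h1 : ‖Tlin F‖ ^ 2 ≤ ‖Tlin F‖ * Nsem F := by
    calc ‖Tlin F‖ ^ 2 = gR ((starRingEnd ℂ) (Tlin F) • F) := hsq
      _ ≤ Nsem ((starRingEnd ℂ) (Tlin F) • F) := gR_le _
      _ = ‖Tlin F‖ * Nsem F := by rw [Nsem_smul, RCLike.norm_conj]
  by_cases h0 : ‖Tlin F‖ = 0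
  · rw [h0]; exact mul_nonneg Cbd_nonneg (SN_nonneg _ _ _)
  · have hpos : 0 < ‖Tlin F‖ := lt_of_le_of_ne (norm_nonneg _) (Ne.symm h0)
    rw [sq] at h1
    exact le_of_mul_le_mul_left h1 hpos

/-- Auxiliary fact `Tlin_eq` of the `ℓ¹`-witness construction (see the module docstring). [folklore] -/
theorem Tlin_eq {F : 𝓢((Fin 2 → E4), ℂ)} (hF : IsOffDiagonal F) : Tlin F = ell F := by
  have hIF : IsOffDiagonal ((RCLike.I : ℂ) • F) := hF.smul _
  rw [Tlin, Module.Dual.extendRCLike_apply, gR_eq hF, gR_eq hIF, ell_smul]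
  have hI : (RCLike.I : ℂ) = Complex.I := rfl
  rw [hI]
  apply Complex.ext
  · simp
  · simp

/-- The Schwartz seminorm family, unfolded (syntactic bridge to `SN`). -/
theorem seminormFamily_eq :
    schwartzSeminormFamily ℂ (Fin 2 → E4) ℂ = fun m => SchwartzMap.seminorm ℂ m.1 m.2 := rfl

/-- Comparison of `SN 9 10` with the `Finset.sup` spelling expected by `mkCLMtoNormedSpace` (the body of
Mathlib's `schwartzSeminormFamily` is not unfolded by the elaborator from here, so we rewrite it first). -/
theorem SN_le_sup (F : 𝓢((Fin 2 → E4), ℂ)) :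
    SN 9 10 F ≤ (Finset.Iic ((9 : ℕ), (10 : ℕ))).sup (schwartzSeminormFamily ℂ (Fin 2 → E4) ℂ) F := by
  rw [seminormFamily_eq]

set_option maxRecDepth 20000 in
/-- **The two-point functional** `T`: a continuous linear functional on `𝓢((ℝ⁴)², ℂ)` which on
`⁰𝒮` is integration against the kernel `K(x₀ − x₁)` (a Hahn–Banach extension of `ℓ`; the unification
of the seminorm bound with `mkCLMtoNormedSpace` unfolds `Finset.Iic (9,10)`, whence the recursion depth). -/
def T : 𝓢((Fin 2 → E4), ℂ) →L[ℂ] ℂ :=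
  SchwartzMap.mkCLMtoNormedSpace (𝕜 := ℂ) (σ := RingHom.id ℂ) Tlin (fun F G => map_add Tlin F G)
    (fun c F => by rw [map_smul]; rfl)
    ⟨_, Cbd, Cbd_nonneg, fun F =>
      (norm_Tlin_le F).trans (mul_le_mul_of_nonneg_left (SN_le_sup F) Cbd_nonneg)⟩

/-- Auxiliary fact `T_apply` of the `ℓ¹`-witness construction (see the module docstring). [folklore] -/
theorem T_apply (F : 𝓢((Fin 2 → E4), ℂ)) : T F = Tlin F := rfl

/-- **Representation on `⁰𝒮`.** -/
theorem T_eq_integral {F : 𝓢((Fin 2 → E4), ℂ)} (hF : IsOffDiagonal F) :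
    T F = ∫ x, KC x * F x := by
  rw [T_apply, Tlin_eq hF, ell]

end Extension


/-! ### Stability of `⁰𝒮` and changes of variables -/

section Symmetry

/-- `⁰𝒮` is stable under precomposition with a continuous linear equivalence preserving the
coincidence locus. -/
theorem isOffDiagonal_precomp {F G : 𝓢((Fin 2 → E4), ℂ)} (hF : IsOffDiagonal F)
    (g : (Fin 2 → E4) ≃L[ℝ] (Fin 2 → E4))
    (hg : ∀ x ∈ coincidenceLocus 2 E4, g x ∈ coincidenceLocus 2 E4)
    (hG : ∀ x, G x = F (g x)) : IsOffDiagonal G := by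
  intro x hx k
  have hfun : (G : (Fin 2 → E4) → ℂ) = (F : (Fin 2 → E4) → ℂ) ∘ g := funext hG
  have key := (g : (Fin 2 → E4) →L[ℝ] (Fin 2 → E4)).iteratedFDeriv_comp_right (F.smooth k) x
    (i := k) le_rfl
  simp only [ContinuousLinearEquiv.coe_coe] at key
  rw [hfun, key, hF _ (hg x hx) k]
  ext m
  simp

/-- Auxiliary fact `isOffDiagonal_translateMulti` of the `ℓ¹`-witness construction (see the module docstring). [folklore] -/
theorem isOffDiagonal_translateMulti {F : 𝓢((Fin 2 → E4), ℂ)} (hF : IsOffDiagonal F) (a : E4) :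
    IsOffDiagonal (translateMulti a F) := by
  intro x hx k
  have hfun : ((translateMulti a F : 𝓢((Fin 2 → E4), ℂ)) : (Fin 2 → E4) → ℂ) =
      fun y => F (y + fun _ => -a) := by
    funext y
    rw [translateMulti_apply]
    congr 1
  rw [hfun, iteratedFDeriv_comp_add_right' k]
  have hmem : (x + fun _ => -a) ∈ coincidenceLocus 2 E4 := by
    obtain ⟨i, j, hij, hxij⟩ := hx
    exact ⟨i, j, hij, by simp [hxij]⟩
  exact hF _ hmem k

/-- Auxiliary fact `isOffDiagonal_linActMulti` of the `ℓ¹`-witness construction (see the module docstring). [folklore] -/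
theorem isOffDiagonal_linActMulti {F : 𝓢((Fin 2 → E4), ℂ)} (hF : IsOffDiagonal F)
    (R : E4 ≃ₗᵢ[ℝ] E4) : IsOffDiagonal (linActMulti R F) :=
  isOffDiagonal_precomp hF
    (ContinuousLinearEquiv.piCongrRight fun _ : Fin 2 => R.symm.toContinuousLinearEquiv)
    (fun x hx => by
      obtain ⟨i, j, hij, hxij⟩ := hx
      exact ⟨i, j, hij, by simp [hxij]⟩)
    (fun x => rfl)

/-- The coordinate permutation `x ↦ x ∘ σ` as a continuous linear equivalence. -/
def permCLE (σ : Equiv.Perm (Fin 2)) : (Fin 2 → E4) ≃L[ℝ] (Fin 2 → E4) :=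
  (LinearEquiv.funCongrLeft ℝ E4 σ).toContinuousLinearEquiv

/-- Auxiliary fact `permCLE_apply` of the `ℓ¹`-witness construction (see the module docstring). [folklore] -/
theorem permCLE_apply (σ : Equiv.Perm (Fin 2)) (x : Fin 2 → E4) : permCLE σ x = x ∘ σ := rfl

/-- Auxiliary fact `isOffDiagonal_permTest` of the `ℓ¹`-witness construction (see the module docstring). [folklore] -/
theorem isOffDiagonal_permTest {F : 𝓢((Fin 2 → E4), ℂ)} (hF : IsOffDiagonal F)
    (σ : Equiv.Perm (Fin 2)) : IsOffDiagonal (permTest σ F) :=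
  isOffDiagonal_precomp hF (permCLE σ)
    (fun x hx => by
      obtain ⟨i, j, hij, hxij⟩ := hx
      refine ⟨σ.symm i, σ.symm j, fun h => hij (σ.symm.injective h), ?_⟩
      simp [permCLE_apply, hxij])
    (fun x => by rw [permTest_apply, permCLE_apply])

/-- Pointwise complex conjugation preserves `⁰𝒮`. -/
theorem isOffDiagonal_starTest {F : 𝓢((Fin 2 → E4), ℂ)} (hF : IsOffDiagonal F) :
    IsOffDiagonal (starTest F) := by
  intro x hx k
  have hfun : ((starTest F : 𝓢((Fin 2 → E4), ℂ)) : (Fin 2 → E4) → ℂ) =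
      (Complex.conjCLE : ℂ →L[ℝ] ℂ) ∘ (F : (Fin 2 → E4) → ℂ) := by
    funext y; simp
  rw [hfun, (Complex.conjCLE : ℂ →L[ℝ] ℂ).iteratedFDeriv_comp_left (F.smooth k).contDiffAt
    (i := k) le_rfl, hF x hx k]
  ext m
  simp

/-- Auxiliary fact `isOffDiagonal_osAdjoint` of the `ℓ¹`-witness construction (see the module docstring). [folklore] -/
theorem isOffDiagonal_osAdjoint {F : 𝓢((Fin 2 → E4), ℂ)} (hF : IsOffDiagonal F) :
    IsOffDiagonal (osAdjoint F) :=
  isOffDiagonal_starTest (isOffDiagonal_linActMulti (isOffDiagonal_permTest hF _) _)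

/-- Change of variables under the diagonal action of a linear isometry. -/
theorem integral_comp_isometry (R : E4 ≃ₗᵢ[ℝ] E4) (G : (Fin 2 → E4) → ℂ) :
    ∫ x : Fin 2 → E4, G (fun i => R (x i)) = ∫ x, G x := by
  have h : MeasurePreserving (fun (x : Fin 2 → E4) (i : Fin 2) => R (x i)) :=
    volume_preserving_pi fun _ => R.measurePreserving
  let e : (Fin 2 → E4) ≃ᵐ (Fin 2 → E4) :=
    MeasurableEquiv.piCongrRight fun _ => R.toHomeomorph.toMeasurableEquiv
  have he : (e : (Fin 2 → E4) → (Fin 2 → E4)) = fun x i => R (x i) := rfl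
  have h' : MeasurePreserving e := by rw [he]; exact h
  exact h'.integral_comp' G

/-- Change of variables under a permutation of the two points. -/
theorem integral_comp_perm (σ : Equiv.Perm (Fin 2)) (G : (Fin 2 → E4) → ℂ) :
    ∫ x : Fin 2 → E4, G (x ∘ σ) = ∫ x, G x := by
  have h := volume_measurePreserving_piCongrLeft (fun _ : Fin 2 => E4) σ.symm
  have he : ∀ x : Fin 2 → E4, (MeasurableEquiv.piCongrLeft (fun _ : Fin 2 => E4) σ.symm) x = x ∘ σ := by
    intro x; funext i
    simp [MeasurableEquiv.coe_piCongrLeft, Equiv.piCongrLeft_apply_eq_cast]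
  have := h.integral_comp' G
  simpa only [he] using this

end Symmetry

end L1Witness

end Summit.QuantumFields.YangMills.Theorems.CurvatureKernelBound.Negative
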